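import Summits.ValiantsHypothesis.ValiantsHypothesis.Theses.BarrierLever
import Summits.ValiantsHypothesis.ValiantsHypothesis.Theorems.BarrierLeverChowHitsPartitionMinorsRLowerSets
import Summits.ValiantsHypothesis.ValiantsHypothesis.Theorems.BarrierLeverChowHitsPartitionMinorsRFacePrivateThin
import Summits.ValiantsHypothesis.ValiantsHypothesis.Theorems.BarrierLeverChowHitsPartitionMinorsRNoStar
import Summits.ValiantsHypothesis.ValiantsHypothesis.Theorems.BarrierLeverChowHitsPartitionMinorsRBiStar
import Summits.ValiantsHypothesis.ValiantsHypothesis.Theorems.BarrierLeverChowHitsPartitionMinorsRStarvedDevice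
import Summits.ValiantsHypothesis.ValiantsHypothesis.Theorems.BarrierLeverChowHitsPartitionMinorsRMatchingDesign
import Summits.ValiantsHypothesis.ValiantsHypothesis.Theorems.BarrierLeverChowHitsPartitionMinorsRHybridArrow
import Summits.ValiantsHypothesis.ValiantsHypothesis.Theorems.BarrierLeverChowHitsPartitionMinorsRNoStarGlue

/-!
# Line `affine_lower` — item stmt-ValiantsHypothesis-21882 `ChowHitsPartitionMinorsR`
# (every injective layout is hit by a product of `h·h` affine forms in `x ⊔ y`, all large `h`) —
# REGISTRY v1 (planner valiant-natproofs-p1 g24, 2026-08-29T10:53Z)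

D-0145 line registry for the rank-9 SUPPORT item 21882 of route-ValiantsHypothesis-BarrierLever (not a
binder of `closes`; nothing here bears on stmt-14610 / stmt-8745 / `VP ≠ VNP`).

CURRENT STATE (v1, 2026-08-29T10:53Z; STATUS l.1752–1753, l.1767 sig-first decision, executed on the landing of
val-np-p5 g29's THEOREM FP files `…ChowHitsPartitionMinorsRFacePrivateDesign` (p712585) + `…FacePrivateThin` (p714167, the arrows G1/G2)). LANDED DEVICES (by name):
(i) the witness-agnostic DOWN-COMPRESSION `ChowLowerSets.iterate_x / iterate_y` and the arrow
`ChowLowerSets.chowHitsPartitionMinorsR_of_lowerSets` (p704381: lower-set pairs at budget `m + 2h ≤ h·h` ⟹ the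
item); (ii) THEOREM FP `ChowFacePrivate.chowHits_of_lowerRows` (a LOWER-SET row family against ANY injective column
family is hit by `Σ_j |w j|` affine forms — the face-private roots-of-unity design) with the planner's arrows
**G1 `ChowFacePrivate.chowHits_of_thin`** (every layout with `‖u‖ + h ≤ h·h ∨ ‖w‖ + h ≤ h·h` is hit by `h·h` forms,
EVERY `h`; `‖u‖ := Σ_i |u i|`) and **G2 `ChowFacePrivate.exists_chow_of_thinLowerSets`** (every lower-set pair with
`‖v‖ + 2h ≤ h·h ∨ ‖w'‖ + 2h ≤ h·h` is hit within budget `m + 2h ≤ h·h`); (iii) 21850 `ChowHitsThinRowPartitionMinorsR`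
PROVED (p699773; all rows of size ≤ 2). WEAKEST-NODE READING ⇒ TWO REGISTERED NODES, each an alternative one-stub
route to the item:
* **`stub_thickPairsChowR`** := the item VERBATIM restricted to THICK pairs (`h·h < ‖u‖ + h` and `h·h < ‖w‖ + h`) —
  the residual of G1; glue `ChowHitsPartitionMinorsR_of` (case split over G1; kernel, no sorry) — THE FIRST LITERAL
  CONCLUDER;
* **`stub_thickLowerSetsChowR`** := p704381's hypothesis VERBATIM (threshold `h₀` bound existentially) restricted to
  THICK LOWER-SET pairs (`h·h < ‖v‖ + 2h` and `h·h < ‖w'‖ + 2h`) — the residual of G2 inside the lower-set node; glue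
  `ChowHitsPartitionMinorsR_of_thickLowerSets` (case split over G2, then p704381; concludes `ItemByName`).
NOT REGISTERED (by name only): `Stmt.stub_lowerSetsChowR` (the unrestricted lower-set node; a THEOREM modulo
`stub_thickLowerSetsChowR`, see `stub_lowerSetsChowR_of_thick`). BY-NAME CREDIT: a Theorems file restating
`def Stmt.stub_<name>` verbatim + `theorem stub_<name> : Stmt.stub_<name>` (`--supports stmt-ValiantsHypothesis-21882`).
REFUTER TARGETS OF RECORD: (thickPairs) a thick layout (e.g. R = all `≤ k`-subsets of `[h]`, C = `2^[h−1]`) on which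
every product of `h·h` affine forms has vanishing partition minor; (thickLS) the same inside lower-set pairs at budget
`h·h − 2h`. NEGATIVES (memo MEMO-21882-valnp5-g29.md): bi-star designs (each form one x- or one y-variable) lack the
(2,2) coupling — rank 342/379 on Δ_L(13), 153/172 on KO(18,8); unique-matching LT certificates impossible on
R = ⟨123⟩ ⊔ {4,5} vs C = ⟨12,13,23,14,24⟩; generic budget-2h forms refuted in range (369/379 on Δ_L(13), h = 27).
-/

/-! ## REGISTRY v2 (planner valiant-natproofs-p1, 2026-08-29T13:15Z; RULING R47, STATUS l.1829; triggers = p716670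
`…ChowHitsPartitionMinorsRNoStar` (padding arrow `ChowNoStar.chowHits_mono`, predicate `ChowNoStar.IsXStarCertifiable`, narrowed node
texts) + p720686 `…BarrierLeverChowHitsPartitionMinorsRNoStarGlue` (unconditional glue), val-np-p5 g30)

WEAKEST-NODE NARROWING OF BOTH NODES by «neither x-star- nor y-star-certifiable»: `stub_thickPairsChowR` ↦ **`stub_thickPairsChowRNoStar`**
and `stub_thickLowerSetsChowR` ↦ **`stub_thickLowerSetsChowRNoStar`** (texts = `ChowNoStar.Stmt.stub_…NoStar` VERBATIM: the v1 texts with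
`¬ Summit.ValiantsHypothesis.ValiantsHypothesis.Theorems.BarrierLever.ChowNoStar.IsXStarCertifiable u w → ¬ Summit.ValiantsHypothesis.ValiantsHypothesis.Theorems.BarrierLever.ChowNoStar.IsXStarCertifiable w u →` inserted before the conclusion; `IsXStarCertifiable u w :=
∃ β, det XS(u, w, β) ≠ 0` = the hypothesis of `ChowXStar.chowHits_of_xstarMatrix`, p714438). The narrowed nodes are WEAKER, UNCONDITIONALLY
(x- or y-star-certifiable pairs are hit by h ≤ h·h − 2h forms: p714438 + `chow_hit_swap_fin` + padding `chowHits_mono`; glue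
`ChowNoStar.stub_thickPairsChowR_of_noStar` / `ChowNoStar.stub_thickLowerSetsChowR_of_noStar`, p720686). The v1 texts stay BY NAME (theorems modulo
the narrowed nodes). Literal concluder: `ChowHitsPartitionMinorsR_of : Stmt.stub_thickPairsChowRNoStar → ChowHitsPartitionMinorsR`; the LS lane
concludes `ItemByName`. At h = 5 the members of the LS node are exactly the 2 000 thick ordered lower pairs with CROSSING tail profiles (val-np-p5 g29
memo §11); the reading of record: «two-sided mixing designs for thick crossing-profile lower pairs at budget h² − 2h». REFUTER TARGETS OF RECORD:
(thickPairsNoStar) a thick, doubly non-star-certifiable layout on which every product of h·h affine forms has vanishing partition minor;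
(thickLSNoStar) a thick crossing-profile lower pair needing more than h·h − 2h forms; (T*) an equal-size lower pair not hit by h² − 2h forms.
-/

/-! ## REGISTRY v3 / v3a (planner valiant-natproofs-p1, 2026-08-29T13:16Z, doc amended 13:42Z R61; RULING R51, STATUS l.1848; trigger = p717689 `…ChowHitsPartitionMinorsRBiStar`, val-np-p5 g30)

1:1 NARROWING OF BOTH NODES by «not BI-STAR-certifiable»: `stub_thickPairsChowRNoStar` ↦ **`stub_thickPairsChowRNoBiStar`**, `stub_thickLowerSetsChowRNoStar`
↦ **`stub_thickLowerSetsChowRNoBiStar`** (texts = `ChowNoStar.Stmt.stub_…NoBiStar` VERBATIM: the NoStar texts + `¬ ChowNoStar.IsBiStarCertifiable u w →`;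
`IsBiStarCertifiable u w := ∃ β α, det M[∏_a (1 + x_a + Σ_c β_ac y_c) · ∏_c (1 + Σ_a α_ca x_a + y_c)] ≠ 0` — the 2h-form BI-STAR design). WEAKER, UNCONDITIONALLY
(`ChowNoStar.chowHits_of_isBiStarCertifiable` ∀ M ≥ 2h; glue `stub_thickPairsChowRNoStar_of_noBiStar` / `stub_thickLowerSetsChowRNoStar_of_noBiStar`, p717689).
MEMBERS: NONE with h ≤ 6 (exhaustive census kit j330324 + design zoo j330490/j330747; h = 7, 8 samples j330865/j330964/j330965 clean) —
BUT THE CLASS IS NON-VACUOUS FOR LARGE h (REGISTRY v3a doc amendment, planner p1 g25 2026-08-29T13:42Z, RULING R61; val-np-p5 g31 NEGATIVE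
OF RECORD p722854 `…ChowHitsPartitionMinorsRStarvedPairs`, ns `…BarrierLever.ChowStarvedPairs`): the STARVED PAIRS of val-np-p2 g9 (rows = all
subsets of size ≤ 2 of [n], columns = Δ_L(o): the pairs inside O = {o+1..2o} replaced by triples, n = 2o+1, o ≥ 12) are equal-size LOWER-SET pairs,
both thick, neither x-star-, y-star- nor bi-star-certifiable, and hit by NO product of n + n affine forms (`exists_starvedPair`, `noBiStar_node_nonvacuous`,
`not_biStar_hits_all_lowerPairs` = ¬T**, `not_lowerPairs_hit_by_two_h`); by starvation they need ≥ C(o+1, 2) − n ≈ h²/8 forms. CONSEQUENCES OF RECORD: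
CONJECTURE T** / BFR («bi-star suffices»; memo MEMO-21882-valnp5-g30.md §2–§3) is FALSE for h ≥ 25 and NO 2h-form (more generally no O(h)-form)
design closes either registered node; the registered nodes STAND AS TYPED — their budgets are Θ(h²) (thick pairs: h·h forms; lower-set pairs:
m ≤ h·h − 2h forms) and the starvation bound ≈ h²/8 lies inside both — but they are Θ(h²)-FORM PROBLEMS: the reading «T** ⇒ LS node vacuous ⇒ item»
of v3 is WITHDRAWN. Also of record (p5 g31, paper + numerics o = 4, 5, 6): the g-DESIGN OBSTRUCTION — every design whose forms each involve ≤ 1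
x-variable has corank ≥ C(o, 2) − (o + 1) on (thin rows, Δ_L(o)); candidate positive ∀h family in the right regime: the two-sided STRUCT-A design
{1 + x_a + y_a}_a ∪ {1 + λ_e (x_a + x_b) + s_e·Y_{T(e)}}_{e ∈ NE(C)} (h + c₃ ≤ (h² + h)/2 forms; full rank on every tested (thin rows, faces-≤3 C),
kit j331954–58) = THEOREM-A candidate. UNCONDITIONAL ∀h family already in hand: THEOREM 𝓑_h
(memo §5; class-B thick crossing family hit by ≤ 6h − 12 explicit forms, h ≥ 6; kernel blueprint K2/K3 on p719988 `…RExactGadgets`;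
exhaustive certified computation h = 6 (j331250: 15 840/15 840), h = 7 (j331252: 1 531 530/1 531 530)).
Literal concluder: `ChowHitsPartitionMinorsR_of : Stmt.stub_thickPairsChowRNoBiStar → ChowHitsPartitionMinorsR`. REFUTER TARGET OF RECORD (R61): an equal-size lower-set
pair (resp. a thick pair) meeting the node's hypotheses whose STARVATION NUMBER — the least number of affine forms whose product has a
non-vanishing partition minor on it, bounded below by the B₂/B₃-relation count of `ChowStarve` — exceeds h·h − 2h (resp. h·h): that refutes the node.
-/

/-! ## REGISTRY v4 (planner valiant-natproofs-p1 g25, 2026-08-29T15:48Z; RULINGS R69(c) + R63(c) BUNDLED into ONE move; triggers = p728631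
`…ChowHitsPartitionMinorsRStarvedDevice` and p729761 `…ChowHitsPartitionMinorsRMatchingDesign`, val-np-p5 g32)

1:1 NARROWING OF BOTH NODES by «not a STARVED pair (either orientation)» AND «not MD-certifiable within budget»:
`stub_thickPairsChowRNoBiStar` ↦ **`stub_thickPairsChowRNoMD`**, `stub_thickLowerSetsChowRNoBiStar` ↦ **`stub_thickLowerSetsChowRNoMD`**
(texts = `ChowNoStar.Stmt.stub_…NoMD` VERBATIM = the NoBiStar texts + `¬ IsStarvedPair u w → ¬ IsStarvedPair w u →` (p728631) +
`¬ (ChowMD.IsMDCertifiable u w ∧ h + #rowDefect u w ≤ h·h) →` (pairs) / `… + 2h ≤ h·h` (lower sets) (p729761); the intermediate NoStarved texts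
`ChowNoStar.Stmt.stub_…NoStarved` are carried too, all four certified by `Iff.rfl` bridges). WEAKER, UNCONDITIONALLY: glue
`ChowNoStar.stub_thickPairsChowRNoStarved_of_noMD` / `stub_thickLowerSetsChowRNoStarved_of_noMD` (p729761; `ChowMD.chowHits_of_isMDCertifiable` ∀ M ≥ h + #rowDefect)
and `ChowNoStar.stub_thickPairsChowRNoBiStar_of_noStarved` / `stub_thickLowerSetsChowRNoBiStar_of_noStarved` (p728631; THEOREM A′ = p727261
`ChowStarvedDesign.chowHits_of_starved` through the device arrow `chowHits_of_isStarvedPair[_swap]` ∀ M ≥ h + C(h,2); budgets `add_choose_two_le_sq`,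
`add_choose_two_add_le_sq`, threshold max h₀ 5 on the LS node). So the v3a NoBiStar nodes and the NoStar / v1 texts are THEOREMS modulo the NoMD nodes.
WHY: every O(h)-form design is DEAD on the residual (p722854 `exists_starvedPair`, starvation ≈ h²/8: T**/BFR refuted by name, R61) while THEOREM A′
(10-file chain p723885 … p727261) hits every starved pair with h + c₃ ≤ h + C(h,2) ≤ h·h explicit integer forms — the first ∀h kernel family INSIDE the
residual; the starved killers of record (`ChowStarvedPairs.starvedU/W`, p729212) ARE `IsStarvedPair` (p729801 `isStarvedPair_starved`) and the v3a
non-vacuity witnesses are excluded by name (`noBiStar_witnesses_starved`). CONJECTURE MD (`ChowMD.Stmt.conjMD`, typed NOT asserted; mixed design with a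
re-matching φ on the row defect; exhaustive h ≤ 5 + samples, 0 failures) is the DESIGN OF RECORD BY NAME (R63): under `conjMD ∧ conjLargeDefect` the NoMD
LS node holds (`ChowNoStar.stub_thickLowerSetsChowRNoMD_of_conj`) — both conjuncts OPEN. MEMBERS OF THE v4 NODES: NONE known by name (the LS node has no
member known at all; R72-style residual of record = thick lower pairs, not x-star / y-star / bi-star / starved, not MD-certifiable within budget).
Literal concluder: `ChowHitsPartitionMinorsR_of : Stmt.stub_thickPairsChowRNoMD → ChowHitsPartitionMinorsR`. REFUTER TARGET OF RECORD: a thick lower pair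
outside all four certificate classes needing more than h·h (pairs) / h·h − 2h (lower sets) affine forms; cheaper: a pair with NO MD certificate for ANY φ
(kills CONJECTURE MD, not the node).
-/

/-! ## REGISTRY v5 (planner valiant-natproofs-p1 g25, 2026-08-29T16:42Z; RULING R77; trigger = p733136 `…ChowHitsPartitionMinorsRHybridArrow`
(val-np-p5 g32) on top of THEOREM H p732931 `…ChowHitsPartitionMinorsRHybridDesign` (`ChowHybrid.chowHits_of_hybrid`))

1:1 NARROWING OF THE LOWER-SETS NODE by «both defect masses beyond the budget»:
`stub_thickLowerSetsChowRNoMD` ↦ **`stub_thickLowerSetsChowRLargeDefect`** (text = `ChowNoStar.Stmt.stub_thickLowerSetsChowRLargeDefect` VERBATIM =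
the NoMD LS text + `h·h < h + ChowHybrid.colDefectMass v w' + 2h →` + `h·h < h + ChowHybrid.colDefectMass w' v + 2h →`, where
`colDefectMass u w = Σ_{j : w j ∉ range u} |w j|` = ‖C∖R‖; certified by an `Iff.rfl` bridge). WEAKER, UNCONDITIONALLY: glue
`ChowNoStar.stub_thickLowerSetsChowRNoMD_of_largeDefect` (p733136; cases: a small defect mass on either side ⇒ `ChowHybrid.exists_chow_of_small_defect`
= THEOREM H within the LS budget m + 2h ≤ h·h; else the new node). So the v4 NoMD LS node, and below it the NoStarved / NoBiStar / NoStar / v1 LS texts,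
are THEOREMS modulo the large-defect node. THE THICK-PAIRS NODE `stub_thickPairsChowRNoMD` (the LITERAL CONCLUDER's hypothesis) IS UNCHANGED — THEOREM H
needs lower-set ranges; the pairs node reaches lower sets only through down-compression (p704381), which does not preserve the defect masses.
WHY: THEOREM H (hybrid design: the h base forms 1 + x_a + y_a plus one face-private rotated group of |W| forms per defect column W ∈ C∖R; kernel chain
p731065 ShiftCalculus → p732352 HybridBase → p732710 HybridColumns → p732508 HybridLeading → p732931 HybridDesign, 0 sorry) hits EVERY injective
equal-size lower-set pair with h + min(‖R∖C‖, ‖C∖R‖) affine forms; `ChowNoStar.lowerSets_smallDefect_hit` (p733136) is the unconditional corollary: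
every injective lower-set pair with h + ‖C∖R‖ + 2h ≤ h·h or h + ‖R∖C‖ + 2h ≤ h·h is hit within the LS budget — no thickness, no star hypotheses.
G2 / bi-star / starved / MD-small-defect are thereby SUBSUMED for the budget question (their exclusions stay verbatim in the node text — harmless);
CONJECTURE MD (`ChowMD.Stmt.conjMD`) remains the finer (cheaper) design conjecture BY NAME (R63). RESIDUAL OF RECORD (R77) = the LARGE-DEFECT REGIME:
thick lower-set pairs with ‖R∖C‖ > h·h − 3h AND ‖C∖R‖ > h·h − 3h outside the four certificate classes (`ChowMD.Stmt.conjLargeDefect` territory; it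
contains the order-3 starved pairs with C(o,3) > (h·h − 3h)/3, numerically easy: m* ≈ n generic forms, kit j333340). MEMBERS known by name: none below
h = 7 needing more than the budget (H numerics: 0 failures h ≤ 6, 538 pairs; kit j333647 / j333648 for h = 7, 8). REFUTER TARGET OF RECORD: a
large-defect thick lower pair needing more than h·h − 2h affine forms. Registered stubs after v5: `stub_thickPairsChowRNoMD` (concluder),
`stub_thickLowerSetsChowRLargeDefect`. Literal concluder unchanged: `ChowHitsPartitionMinorsR_of : Stmt.stub_thickPairsChowRNoMD → ChowHitsPartitionMinorsR`.
-/

set_option linter.dupNamespace false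

namespace Summit.ValiantsHypothesis.ValiantsHypothesis.Cruxes.ChowHitsPartitionMinorsR.AffineLower

open Finset MvPolynomial
open Summit.ValiantsHypothesis.ValiantsHypothesis.Theses.BarrierLever
open Summit.ValiantsHypothesis.ValiantsHypothesis.Theorems.BarrierLever

/-- The item, by name (audit alias: compositions whose hypotheses are not registered stubs conclude this). -/
abbrev ItemByName : Prop := ChowHitsPartitionMinorsR

theorem itemByName_iff : ItemByName ↔ ChowHitsPartitionMinorsR := Iff.rfl

/-! ## Node texts -/

/-- NODE (by name, not registered): lower-set pairs at budget `m + 2h ≤ h·h` — the hypothesis of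
`ChowLowerSets.chowHitsPartitionMinorsR_of_lowerSets` (p704381) with `h₀` bound existentially. -/
def Stmt.stub_lowerSetsChowR : Prop :=
  ∃ h₀ : ℕ, ∀ h : ℕ, h₀ ≤ h → ∀ (r : ℕ) (v w' : Fin r → Finset (Fin h)),
    Function.Injective v → Function.Injective w' →
    IsLowerSet (Set.range v) → IsLowerSet (Set.range w') →
    ∃ m : ℕ, m + 2 * h ≤ h * h ∧ ∃ ℓ : Fin m → MvPolynomial (Fin (h + h)) ℂ,
      (∀ k, (ℓ k).totalDegree ≤ 1) ∧
      (Matrix.of fun i j : Fin r => MvPolynomial.coeff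
        (∑ a ∈ v i, Finsupp.single (Fin.castAdd h a) 1 +
          ∑ c ∈ w' j, Finsupp.single (Fin.natAdd h c) 1) (∏ k, ℓ k)).det ≠ 0

/-- **NODE v1a (REGISTERED): THICK PAIRS** — the item VERBATIM restricted to layouts with both total sizes
`‖u‖ = Σ_i |u i|` and `‖w‖` exceeding `h·h − h` (the complement of G1 `ChowFacePrivate.chowHits_of_thin`).
WHY IT MIGHT FAIL: a thick layout on which every product of `h·h` affine forms has vanishing partition minor
(candidate: all `≤ k`-subsets of `[h]` vs `2^[h−1]`; generic forms hit it numerically at small `h`). -/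
def Stmt.stub_thickPairsChowR : Prop :=
  ∃ h₀ : ℕ, ∀ h : ℕ, h₀ ≤ h → ∀ (r : ℕ) (u w : Fin r → Finset (Fin h)),
    Function.Injective u → Function.Injective w →
    h * h < (∑ i, (u i).card) + h → h * h < (∑ j, (w j).card) + h →
    ∃ ℓ : Fin (h * h) → MvPolynomial (Fin (h + h)) ℂ,
      (∀ k, (ℓ k).totalDegree ≤ 1) ∧
      (Matrix.of fun i j : Fin r => MvPolynomial.coeff
        (∑ a ∈ u i, Finsupp.single (Fin.castAdd h a) 1 +
          ∑ c ∈ w j, Finsupp.single (Fin.natAdd h c) 1) (∏ k, ℓ k)).det ≠ 0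

/-- **NODE v1b (REGISTERED): THICK LOWER-SET PAIRS at budget `m + 2h ≤ h·h`** — `Stmt.stub_lowerSetsChowR`
VERBATIM restricted to lower-set pairs with both total sizes exceeding `h·h − 2h` (the complement of G2
`ChowFacePrivate.exists_chow_of_thinLowerSets`). WHY IT MIGHT FAIL: a thick lower-set pair needing more than
`h·h − 2h` forms. -/
def Stmt.stub_thickLowerSetsChowR : Prop :=
  ∃ h₀ : ℕ, ∀ h : ℕ, h₀ ≤ h → ∀ (r : ℕ) (v w' : Fin r → Finset (Fin h)),
    Function.Injective v → Function.Injective w' →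
    IsLowerSet (Set.range v) → IsLowerSet (Set.range w') →
    h * h < (∑ i, (v i).card) + 2 * h → h * h < (∑ j, (w' j).card) + 2 * h →
    ∃ m : ℕ, m + 2 * h ≤ h * h ∧ ∃ ℓ : Fin m → MvPolynomial (Fin (h + h)) ℂ,
      (∀ k, (ℓ k).totalDegree ≤ 1) ∧
      (Matrix.of fun i j : Fin r => MvPolynomial.coeff
        (∑ a ∈ v i, Finsupp.single (Fin.castAdd h a) 1 +
          ∑ c ∈ w' j, Finsupp.single (Fin.natAdd h c) 1) (∏ k, ℓ k)).det ≠ 0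


/-- **NODE (v2, R47): THICK PAIRS, NEITHER x-STAR- NOR y-STAR-CERTIFIABLE** — VERBATIM `ChowNoStar.Stmt.stub_thickPairsChowRNoStar` (p716670). -/
def Stmt.stub_thickPairsChowRNoStar : Prop :=
  ∃ h₀ : ℕ, ∀ h : ℕ, h₀ ≤ h → ∀ (r : ℕ) (u w : Fin r → Finset (Fin h)),
    Function.Injective u → Function.Injective w →
    h * h < (∑ i, (u i).card) + h → h * h < (∑ j, (w j).card) + h →
    ¬ Summit.ValiantsHypothesis.ValiantsHypothesis.Theorems.BarrierLever.ChowNoStar.IsXStarCertifiable u w → ¬ Summit.ValiantsHypothesis.ValiantsHypothesis.Theorems.BarrierLever.ChowNoStar.IsXStarCertifiable w u →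
    ∃ ℓ : Fin (h * h) → MvPolynomial (Fin (h + h)) ℂ,
      (∀ k, (ℓ k).totalDegree ≤ 1) ∧
      (Matrix.of fun i j : Fin r => MvPolynomial.coeff
        (∑ a ∈ u i, Finsupp.single (Fin.castAdd h a) 1 +
          ∑ c ∈ w j, Finsupp.single (Fin.natAdd h c) 1) (∏ k, ℓ k)).det ≠ 0

/-- **NODE (v2, R47): THICK LOWER-SET PAIRS, NEITHER x-STAR- NOR y-STAR-CERTIFIABLE** — VERBATIM `ChowNoStar.Stmt.stub_thickLowerSetsChowRNoStar` (p716670). -/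
def Stmt.stub_thickLowerSetsChowRNoStar : Prop :=
  ∃ h₀ : ℕ, ∀ h : ℕ, h₀ ≤ h → ∀ (r : ℕ) (v w' : Fin r → Finset (Fin h)),
    Function.Injective v → Function.Injective w' →
    IsLowerSet (Set.range v) → IsLowerSet (Set.range w') →
    h * h < (∑ i, (v i).card) + 2 * h → h * h < (∑ j, (w' j).card) + 2 * h →
    ¬ Summit.ValiantsHypothesis.ValiantsHypothesis.Theorems.BarrierLever.ChowNoStar.IsXStarCertifiable v w' → ¬ Summit.ValiantsHypothesis.ValiantsHypothesis.Theorems.BarrierLever.ChowNoStar.IsXStarCertifiable w' v →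
    ∃ m : ℕ, m + 2 * h ≤ h * h ∧ ∃ ℓ : Fin m → MvPolynomial (Fin (h + h)) ℂ,
      (∀ k, (ℓ k).totalDegree ≤ 1) ∧
      (Matrix.of fun i j : Fin r => MvPolynomial.coeff
        (∑ a ∈ v i, Finsupp.single (Fin.castAdd h a) 1 +
          ∑ c ∈ w' j, Finsupp.single (Fin.natAdd h c) 1) (∏ k, ℓ k)).det ≠ 0

theorem stub_thickPairsChowR_iff : Stmt.stub_thickPairsChowR ↔ Summit.ValiantsHypothesis.ValiantsHypothesis.Theorems.BarrierLever.ChowNoStar.Stmt.stub_thickPairsChowR := Iff.rfl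
theorem stub_thickLowerSetsChowR_iff : Stmt.stub_thickLowerSetsChowR ↔ Summit.ValiantsHypothesis.ValiantsHypothesis.Theorems.BarrierLever.ChowNoStar.Stmt.stub_thickLowerSetsChowR := Iff.rfl
theorem stub_thickPairsChowRNoStar_iff : Stmt.stub_thickPairsChowRNoStar ↔ Summit.ValiantsHypothesis.ValiantsHypothesis.Theorems.BarrierLever.ChowNoStar.Stmt.stub_thickPairsChowRNoStar := Iff.rfl
theorem stub_thickLowerSetsChowRNoStar_iff :
    Stmt.stub_thickLowerSetsChowRNoStar ↔ Summit.ValiantsHypothesis.ValiantsHypothesis.Theorems.BarrierLever.ChowNoStar.Stmt.stub_thickLowerSetsChowRNoStar := Iff.rfl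


/-- **NODE (v3, R51): THICK PAIRS, NEITHER STAR- NOR BI-STAR-CERTIFIABLE** — VERBATIM `ChowNoStar.Stmt.stub_thickPairsChowRNoBiStar` (p717689). -/
def Stmt.stub_thickPairsChowRNoBiStar : Prop :=
  ∃ h₀ : ℕ, ∀ h : ℕ, h₀ ≤ h → ∀ (r : ℕ) (u w : Fin r → Finset (Fin h)),
    Function.Injective u → Function.Injective w →
    h * h < (∑ i, (u i).card) + h → h * h < (∑ j, (w j).card) + h →
    ¬ Summit.ValiantsHypothesis.ValiantsHypothesis.Theorems.BarrierLever.ChowNoStar.IsXStarCertifiable u w → ¬ Summit.ValiantsHypothesis.ValiantsHypothesis.Theorems.BarrierLever.ChowNoStar.IsXStarCertifiable w u → ¬ Summit.ValiantsHypothesis.ValiantsHypothesis.Theorems.BarrierLever.ChowNoStar.IsBiStarCertifiable u w →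
    ∃ ℓ : Fin (h * h) → MvPolynomial (Fin (h + h)) ℂ,
      (∀ k, (ℓ k).totalDegree ≤ 1) ∧
      (Matrix.of fun i j : Fin r => MvPolynomial.coeff
        (∑ a ∈ u i, Finsupp.single (Fin.castAdd h a) 1 +
          ∑ c ∈ w j, Finsupp.single (Fin.natAdd h c) 1) (∏ k, ℓ k)).det ≠ 0

/-- **NODE (v3, R51): THICK LOWER-SET PAIRS, NEITHER STAR- NOR BI-STAR-CERTIFIABLE** — VERBATIM `ChowNoStar.Stmt.stub_thickLowerSetsChowRNoBiStar` (p717689). -/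
def Stmt.stub_thickLowerSetsChowRNoBiStar : Prop :=
  ∃ h₀ : ℕ, ∀ h : ℕ, h₀ ≤ h → ∀ (r : ℕ) (v w' : Fin r → Finset (Fin h)),
    Function.Injective v → Function.Injective w' →
    IsLowerSet (Set.range v) → IsLowerSet (Set.range w') →
    h * h < (∑ i, (v i).card) + 2 * h → h * h < (∑ j, (w' j).card) + 2 * h →
    ¬ Summit.ValiantsHypothesis.ValiantsHypothesis.Theorems.BarrierLever.ChowNoStar.IsXStarCertifiable v w' → ¬ Summit.ValiantsHypothesis.ValiantsHypothesis.Theorems.BarrierLever.ChowNoStar.IsXStarCertifiable w' v → ¬ Summit.ValiantsHypothesis.ValiantsHypothesis.Theorems.BarrierLever.ChowNoStar.IsBiStarCertifiable v w' →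
    ∃ m : ℕ, m + 2 * h ≤ h * h ∧ ∃ ℓ : Fin m → MvPolynomial (Fin (h + h)) ℂ,
      (∀ k, (ℓ k).totalDegree ≤ 1) ∧
      (Matrix.of fun i j : Fin r => MvPolynomial.coeff
        (∑ a ∈ v i, Finsupp.single (Fin.castAdd h a) 1 +
          ∑ c ∈ w' j, Finsupp.single (Fin.natAdd h c) 1) (∏ k, ℓ k)).det ≠ 0

theorem stub_thickPairsChowRNoBiStar_iff : Stmt.stub_thickPairsChowRNoBiStar ↔ Summit.ValiantsHypothesis.ValiantsHypothesis.Theorems.BarrierLever.ChowNoStar.Stmt.stub_thickPairsChowRNoBiStar := Iff.rfl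
theorem stub_thickLowerSetsChowRNoBiStar_iff :
    Stmt.stub_thickLowerSetsChowRNoBiStar ↔ Summit.ValiantsHypothesis.ValiantsHypothesis.Theorems.BarrierLever.ChowNoStar.Stmt.stub_thickLowerSetsChowRNoBiStar := Iff.rfl


/-- **NODE (v4 intermediate, R69(c)): THICK PAIRS, not star / bi-star / STARVED** — VERBATIM `ChowNoStar.Stmt.stub_thickPairsChowRNoStarved` (p728631). -/
def Stmt.stub_thickPairsChowRNoStarved : Prop :=
  ∃ h₀ : ℕ, ∀ h : ℕ, h₀ ≤ h → ∀ (r : ℕ) (u w : Fin r → Finset (Fin h)),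
    Function.Injective u → Function.Injective w →
    h * h < (∑ i, (u i).card) + h → h * h < (∑ j, (w j).card) + h →
    ¬ Summit.ValiantsHypothesis.ValiantsHypothesis.Theorems.BarrierLever.ChowNoStar.IsXStarCertifiable u w → ¬ Summit.ValiantsHypothesis.ValiantsHypothesis.Theorems.BarrierLever.ChowNoStar.IsXStarCertifiable w u → ¬ Summit.ValiantsHypothesis.ValiantsHypothesis.Theorems.BarrierLever.ChowNoStar.IsBiStarCertifiable u w →
    ¬ Summit.ValiantsHypothesis.ValiantsHypothesis.Theorems.BarrierLever.ChowStarvedDesign.IsStarvedPair u w →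
    ¬ Summit.ValiantsHypothesis.ValiantsHypothesis.Theorems.BarrierLever.ChowStarvedDesign.IsStarvedPair w u →
    ∃ ℓ : Fin (h * h) → MvPolynomial (Fin (h + h)) ℂ,
      (∀ k, (ℓ k).totalDegree ≤ 1) ∧
      (Matrix.of fun i j : Fin r => MvPolynomial.coeff
        (∑ a ∈ u i, Finsupp.single (Fin.castAdd h a) 1 +
          ∑ c ∈ w j, Finsupp.single (Fin.natAdd h c) 1) (∏ k, ℓ k)).det ≠ 0

/-- **NODE (v4 intermediate, R69(c)): THICK LOWER-SET PAIRS, not star / bi-star / STARVED** — VERBATIM `ChowNoStar.Stmt.stub_thickLowerSetsChowRNoStarved` (p728631). -/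
def Stmt.stub_thickLowerSetsChowRNoStarved : Prop :=
  ∃ h₀ : ℕ, ∀ h : ℕ, h₀ ≤ h → ∀ (r : ℕ) (v w' : Fin r → Finset (Fin h)),
    Function.Injective v → Function.Injective w' →
    IsLowerSet (Set.range v) → IsLowerSet (Set.range w') →
    h * h < (∑ i, (v i).card) + 2 * h → h * h < (∑ j, (w' j).card) + 2 * h →
    ¬ Summit.ValiantsHypothesis.ValiantsHypothesis.Theorems.BarrierLever.ChowNoStar.IsXStarCertifiable v w' → ¬ Summit.ValiantsHypothesis.ValiantsHypothesis.Theorems.BarrierLever.ChowNoStar.IsXStarCertifiable w' v → ¬ Summit.ValiantsHypothesis.ValiantsHypothesis.Theorems.BarrierLever.ChowNoStar.IsBiStarCertifiable v w' →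
    ¬ Summit.ValiantsHypothesis.ValiantsHypothesis.Theorems.BarrierLever.ChowStarvedDesign.IsStarvedPair v w' →
    ¬ Summit.ValiantsHypothesis.ValiantsHypothesis.Theorems.BarrierLever.ChowStarvedDesign.IsStarvedPair w' v →
    ∃ m : ℕ, m + 2 * h ≤ h * h ∧ ∃ ℓ : Fin m → MvPolynomial (Fin (h + h)) ℂ,
      (∀ k, (ℓ k).totalDegree ≤ 1) ∧
      (Matrix.of fun i j : Fin r => MvPolynomial.coeff
        (∑ a ∈ v i, Finsupp.single (Fin.castAdd h a) 1 +
          ∑ c ∈ w' j, Finsupp.single (Fin.natAdd h c) 1) (∏ k, ℓ k)).det ≠ 0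

/-- **NODE (v4, REGISTERED, R69(c)+R63(c)): THICK PAIRS, not star / bi-star / starved, NOT MD-CERTIFIABLE WITHIN BUDGET** —
VERBATIM `ChowNoStar.Stmt.stub_thickPairsChowRNoMD` (p729761). WHY IT MIGHT FAIL: a thick pair outside all four classes needing > h·h forms. -/
def Stmt.stub_thickPairsChowRNoMD : Prop :=
  ∃ h₀ : ℕ, ∀ h : ℕ, h₀ ≤ h → ∀ (r : ℕ) (u w : Fin r → Finset (Fin h)),
    Function.Injective u → Function.Injective w →
    h * h < (∑ i, (u i).card) + h → h * h < (∑ j, (w j).card) + h →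
    ¬ Summit.ValiantsHypothesis.ValiantsHypothesis.Theorems.BarrierLever.ChowNoStar.IsXStarCertifiable u w → ¬ Summit.ValiantsHypothesis.ValiantsHypothesis.Theorems.BarrierLever.ChowNoStar.IsXStarCertifiable w u → ¬ Summit.ValiantsHypothesis.ValiantsHypothesis.Theorems.BarrierLever.ChowNoStar.IsBiStarCertifiable u w →
    ¬ Summit.ValiantsHypothesis.ValiantsHypothesis.Theorems.BarrierLever.ChowStarvedDesign.IsStarvedPair u w →
    ¬ Summit.ValiantsHypothesis.ValiantsHypothesis.Theorems.BarrierLever.ChowStarvedDesign.IsStarvedPair w u →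
    ¬ (Summit.ValiantsHypothesis.ValiantsHypothesis.Theorems.BarrierLever.ChowMD.IsMDCertifiable u w ∧
        h + Fintype.card (Summit.ValiantsHypothesis.ValiantsHypothesis.Theorems.BarrierLever.ChowMD.rowDefect u w) ≤ h * h) →
    ∃ ℓ : Fin (h * h) → MvPolynomial (Fin (h + h)) ℂ,
      (∀ k, (ℓ k).totalDegree ≤ 1) ∧
      (Matrix.of fun i j : Fin r => MvPolynomial.coeff
        (∑ a ∈ u i, Finsupp.single (Fin.castAdd h a) 1 +
          ∑ c ∈ w j, Finsupp.single (Fin.natAdd h c) 1) (∏ k, ℓ k)).det ≠ 0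

/-- **NODE (v4, REGISTERED, R69(c)+R63(c)): THICK LOWER-SET PAIRS, not star / bi-star / starved, NOT MD-CERTIFIABLE WITHIN BUDGET** —
VERBATIM `ChowNoStar.Stmt.stub_thickLowerSetsChowRNoMD` (p729761). WHY IT MIGHT FAIL: a thick lower pair outside all four classes needing > h·h − 2h forms;
under CONJECTURE MD its members all lie in the OPEN large-defect regime (`ChowMD.Stmt.conjLargeDefect`). -/
def Stmt.stub_thickLowerSetsChowRNoMD : Prop :=
  ∃ h₀ : ℕ, ∀ h : ℕ, h₀ ≤ h → ∀ (r : ℕ) (v w' : Fin r → Finset (Fin h)),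
    Function.Injective v → Function.Injective w' →
    IsLowerSet (Set.range v) → IsLowerSet (Set.range w') →
    h * h < (∑ i, (v i).card) + 2 * h → h * h < (∑ j, (w' j).card) + 2 * h →
    ¬ Summit.ValiantsHypothesis.ValiantsHypothesis.Theorems.BarrierLever.ChowNoStar.IsXStarCertifiable v w' → ¬ Summit.ValiantsHypothesis.ValiantsHypothesis.Theorems.BarrierLever.ChowNoStar.IsXStarCertifiable w' v → ¬ Summit.ValiantsHypothesis.ValiantsHypothesis.Theorems.BarrierLever.ChowNoStar.IsBiStarCertifiable v w' →
    ¬ Summit.ValiantsHypothesis.ValiantsHypothesis.Theorems.BarrierLever.ChowStarvedDesign.IsStarvedPair v w' →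
    ¬ Summit.ValiantsHypothesis.ValiantsHypothesis.Theorems.BarrierLever.ChowStarvedDesign.IsStarvedPair w' v →
    ¬ (Summit.ValiantsHypothesis.ValiantsHypothesis.Theorems.BarrierLever.ChowMD.IsMDCertifiable v w' ∧
        h + Fintype.card (Summit.ValiantsHypothesis.ValiantsHypothesis.Theorems.BarrierLever.ChowMD.rowDefect v w') + 2 * h
          ≤ h * h) →
    ∃ m : ℕ, m + 2 * h ≤ h * h ∧ ∃ ℓ : Fin m → MvPolynomial (Fin (h + h)) ℂ,
      (∀ k, (ℓ k).totalDegree ≤ 1) ∧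
      (Matrix.of fun i j : Fin r => MvPolynomial.coeff
        (∑ a ∈ v i, Finsupp.single (Fin.castAdd h a) 1 +
          ∑ c ∈ w' j, Finsupp.single (Fin.natAdd h c) 1) (∏ k, ℓ k)).det ≠ 0

theorem stub_thickPairsChowRNoStarved_iff : Stmt.stub_thickPairsChowRNoStarved ↔ Summit.ValiantsHypothesis.ValiantsHypothesis.Theorems.BarrierLever.ChowNoStar.Stmt.stub_thickPairsChowRNoStarved := Iff.rfl
theorem stub_thickLowerSetsChowRNoStarved_iff :
    Stmt.stub_thickLowerSetsChowRNoStarved ↔ Summit.ValiantsHypothesis.ValiantsHypothesis.Theorems.BarrierLever.ChowNoStar.Stmt.stub_thickLowerSetsChowRNoStarved := Iff.rfl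
theorem stub_thickPairsChowRNoMD_iff : Stmt.stub_thickPairsChowRNoMD ↔ Summit.ValiantsHypothesis.ValiantsHypothesis.Theorems.BarrierLever.ChowNoStar.Stmt.stub_thickPairsChowRNoMD := Iff.rfl
theorem stub_thickLowerSetsChowRNoMD_iff : Stmt.stub_thickLowerSetsChowRNoMD ↔ Summit.ValiantsHypothesis.ValiantsHypothesis.Theorems.BarrierLever.ChowNoStar.Stmt.stub_thickLowerSetsChowRNoMD := Iff.rfl


/-- **NODE (v5, REGISTERED, R77 / THEOREM H): THICK LOWER-SET PAIRS, not star / bi-star / starved / MD-within-budget, WITH BOTH DEFECT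
MASSES BEYOND THE BUDGET** — VERBATIM `ChowNoStar.Stmt.stub_thickLowerSetsChowRLargeDefect` (p733136). WHY IT MIGHT FAIL: a large-defect thick
lower pair (‖R∖C‖, ‖C∖R‖ > h·h − 3h) outside all certificate classes needing > h·h − 2h forms. -/
def Stmt.stub_thickLowerSetsChowRLargeDefect : Prop :=
  ∃ h₀ : ℕ, ∀ h : ℕ, h₀ ≤ h → ∀ (r : ℕ) (v w' : Fin r → Finset (Fin h)),
    Function.Injective v → Function.Injective w' →
    IsLowerSet (Set.range v) → IsLowerSet (Set.range w') →
    h * h < (∑ i, (v i).card) + 2 * h → h * h < (∑ j, (w' j).card) + 2 * h →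
    ¬ Summit.ValiantsHypothesis.ValiantsHypothesis.Theorems.BarrierLever.ChowNoStar.IsXStarCertifiable v w' → ¬ Summit.ValiantsHypothesis.ValiantsHypothesis.Theorems.BarrierLever.ChowNoStar.IsXStarCertifiable w' v → ¬ Summit.ValiantsHypothesis.ValiantsHypothesis.Theorems.BarrierLever.ChowNoStar.IsBiStarCertifiable v w' →
    ¬ Summit.ValiantsHypothesis.ValiantsHypothesis.Theorems.BarrierLever.ChowStarvedDesign.IsStarvedPair v w' →
    ¬ Summit.ValiantsHypothesis.ValiantsHypothesis.Theorems.BarrierLever.ChowStarvedDesign.IsStarvedPair w' v →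
    ¬ (Summit.ValiantsHypothesis.ValiantsHypothesis.Theorems.BarrierLever.ChowMD.IsMDCertifiable v w' ∧
        h + Fintype.card (Summit.ValiantsHypothesis.ValiantsHypothesis.Theorems.BarrierLever.ChowMD.rowDefect v w') + 2 * h
          ≤ h * h) →
    h * h < h + Summit.ValiantsHypothesis.ValiantsHypothesis.Theorems.BarrierLever.ChowHybrid.colDefectMass v w' + 2 * h →
    h * h < h + Summit.ValiantsHypothesis.ValiantsHypothesis.Theorems.BarrierLever.ChowHybrid.colDefectMass w' v + 2 * h →
    ∃ m : ℕ, m + 2 * h ≤ h * h ∧ ∃ ℓ : Fin m → MvPolynomial (Fin (h + h)) ℂ,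
      (∀ k, (ℓ k).totalDegree ≤ 1) ∧
      (Matrix.of fun i j : Fin r => MvPolynomial.coeff
        (∑ a ∈ v i, Finsupp.single (Fin.castAdd h a) 1 +
          ∑ c ∈ w' j, Finsupp.single (Fin.natAdd h c) 1) (∏ k, ℓ k)).det ≠ 0

theorem stub_thickLowerSetsChowRLargeDefect_iff :
    Stmt.stub_thickLowerSetsChowRLargeDefect ↔ Summit.ValiantsHypothesis.ValiantsHypothesis.Theorems.BarrierLever.ChowNoStar.Stmt.stub_thickLowerSetsChowRLargeDefect := Iff.rfl

/-! ## Registered stubs (v5: exactly two — the NoMD thick-pairs node (concluder) and the LARGE-DEFECT lower-sets node; the NoMD LS, NoStarved, NoBiStar, NoStar and v1 texts are theorems modulo them) -/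

/-- **REGISTERED STUB v1a — thick pairs (the concluding node).** OPEN. -/
theorem stub_thickPairsChowRNoMD : Stmt.stub_thickPairsChowRNoMD := by
  sorry

/-- v4 (R63(c)): the NoStarved node is a THEOREM modulo the NoMD node (p729761 `ChowNoStar.stub_thickPairsChowRNoStarved_of_noMD`). -/
theorem stub_thickPairsChowRNoStarved : Stmt.stub_thickPairsChowRNoStarved :=
  stub_thickPairsChowRNoStarved_iff.mpr (Summit.ValiantsHypothesis.ValiantsHypothesis.Theorems.BarrierLever.ChowNoStar.stub_thickPairsChowRNoStarved_of_noMD (stub_thickPairsChowRNoMD_iff.mp stub_thickPairsChowRNoMD))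

/-- v4 (R69(c)): the NoBiStar node is a THEOREM modulo the NoStarved node (p728631 `ChowNoStar.stub_thickPairsChowRNoBiStar_of_noStarved`; THEOREM A′ p727261). -/
theorem stub_thickPairsChowRNoBiStar : Stmt.stub_thickPairsChowRNoBiStar :=
  stub_thickPairsChowRNoBiStar_iff.mpr (Summit.ValiantsHypothesis.ValiantsHypothesis.Theorems.BarrierLever.ChowNoStar.stub_thickPairsChowRNoBiStar_of_noStarved (stub_thickPairsChowRNoStarved_iff.mp stub_thickPairsChowRNoStarved))

/-- v3 (R51): the NoStar node is a THEOREM modulo the NoBiStar node (p717689 `ChowNoStar.stub_thickPairsChowRNoStar_of_noBiStar`). -/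
theorem stub_thickPairsChowRNoStar : Stmt.stub_thickPairsChowRNoStar :=
  stub_thickPairsChowRNoStar_iff.mpr (Summit.ValiantsHypothesis.ValiantsHypothesis.Theorems.BarrierLever.ChowNoStar.stub_thickPairsChowRNoStar_of_noBiStar (stub_thickPairsChowRNoBiStar_iff.mp stub_thickPairsChowRNoBiStar))

/-- v2 (R47): the v1 node is a THEOREM modulo the narrowed node (p720686 `ChowNoStar.stub_thickPairsChowR_of_noStar`). -/
theorem stub_thickPairsChowR : Stmt.stub_thickPairsChowR :=
  stub_thickPairsChowR_iff.mpr (Summit.ValiantsHypothesis.ValiantsHypothesis.Theorems.BarrierLever.ChowNoStar.stub_thickPairsChowR_of_noStar (stub_thickPairsChowRNoStar_iff.mp stub_thickPairsChowRNoStar))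

/-- **REGISTERED STUB v1b — thick lower-set pairs (alternative one-stub route).** OPEN. -/
theorem stub_thickLowerSetsChowRLargeDefect : Stmt.stub_thickLowerSetsChowRLargeDefect := by
  sorry

/-- v5 (R77): the NoMD LS node is a THEOREM modulo the large-defect node (p733136 `ChowNoStar.stub_thickLowerSetsChowRNoMD_of_largeDefect`; THEOREM H p732931). -/
theorem stub_thickLowerSetsChowRNoMD : Stmt.stub_thickLowerSetsChowRNoMD :=
  stub_thickLowerSetsChowRNoMD_iff.mpr (Summit.ValiantsHypothesis.ValiantsHypothesis.Theorems.BarrierLever.ChowNoStar.stub_thickLowerSetsChowRNoMD_of_largeDefect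
    (stub_thickLowerSetsChowRLargeDefect_iff.mp stub_thickLowerSetsChowRLargeDefect))

/-- v4 (R63(c)): the NoStarved LS node is a THEOREM modulo the NoMD LS node (p729761 `ChowNoStar.stub_thickLowerSetsChowRNoStarved_of_noMD`). -/
theorem stub_thickLowerSetsChowRNoStarved : Stmt.stub_thickLowerSetsChowRNoStarved :=
  stub_thickLowerSetsChowRNoStarved_iff.mpr (Summit.ValiantsHypothesis.ValiantsHypothesis.Theorems.BarrierLever.ChowNoStar.stub_thickLowerSetsChowRNoStarved_of_noMD (stub_thickLowerSetsChowRNoMD_iff.mp stub_thickLowerSetsChowRNoMD))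

/-- v4 (R69(c)): the NoBiStar LS node is a THEOREM modulo the NoStarved LS node (p728631 `ChowNoStar.stub_thickLowerSetsChowRNoBiStar_of_noStarved`). -/
theorem stub_thickLowerSetsChowRNoBiStar : Stmt.stub_thickLowerSetsChowRNoBiStar :=
  stub_thickLowerSetsChowRNoBiStar_iff.mpr (Summit.ValiantsHypothesis.ValiantsHypothesis.Theorems.BarrierLever.ChowNoStar.stub_thickLowerSetsChowRNoBiStar_of_noStarved (stub_thickLowerSetsChowRNoStarved_iff.mp stub_thickLowerSetsChowRNoStarved))

/-- v3 (R51): the NoStar LS node is a THEOREM modulo the NoBiStar LS node (p717689 `ChowNoStar.stub_thickLowerSetsChowRNoStar_of_noBiStar`). -/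
theorem stub_thickLowerSetsChowRNoStar : Stmt.stub_thickLowerSetsChowRNoStar :=
  stub_thickLowerSetsChowRNoStar_iff.mpr (Summit.ValiantsHypothesis.ValiantsHypothesis.Theorems.BarrierLever.ChowNoStar.stub_thickLowerSetsChowRNoStar_of_noBiStar (stub_thickLowerSetsChowRNoBiStar_iff.mp stub_thickLowerSetsChowRNoBiStar))

/-- v2 (R47): the v1 LS node is a THEOREM modulo the narrowed LS node (p720686 `ChowNoStar.stub_thickLowerSetsChowR_of_noStar`). -/
theorem stub_thickLowerSetsChowR : Stmt.stub_thickLowerSetsChowR :=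
  stub_thickLowerSetsChowR_iff.mpr (Summit.ValiantsHypothesis.ValiantsHypothesis.Theorems.BarrierLever.ChowNoStar.stub_thickLowerSetsChowR_of_noStar (stub_thickLowerSetsChowRNoStar_iff.mp stub_thickLowerSetsChowRNoStar))

/-! ## Glue and compositions (proved, no sorry) -/

/-- **GLUE (kernel): the unrestricted lower-set node from the thick one** — thin lower-set pairs by G2
`ChowFacePrivate.exists_chow_of_thinLowerSets`, thick ones by the node. -/
theorem stub_lowerSetsChowR_of_thick (hT : Stmt.stub_thickLowerSetsChowR) : Stmt.stub_lowerSetsChowR := by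
  obtain ⟨h₀, hT⟩ := hT
  refine ⟨h₀, fun h hh r v w' hv hw hlv hlw => ?_⟩
  by_cases h1 : (∑ i, (v i).card) + 2 * h ≤ h * h ∨ (∑ j, (w' j).card) + 2 * h ≤ h * h
  · exact ChowFacePrivate.exists_chow_of_thinLowerSets h r v w' hv hw hlv hlw h1
  · push Not at h1
    exact hT h hh r v w' hv hw hlv hlw (by omega) (by omega)

/-- **THE SKELETON COMPOSITION (the FIRST literal concluder; kernel-checked): the thick-pairs node closes the
item** — thin pairs by G1 `ChowFacePrivate.chowHits_of_thin` (THEOREM FP + one-sided compression), thick pairs by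
the node. -/
theorem ChowHitsPartitionMinorsR_of_thickPairs : Stmt.stub_thickPairsChowR → ItemByName := by
  rintro ⟨h₀, hT⟩
  refine ⟨h₀, fun h hh r u w hu hw => ?_⟩
  by_cases h1 : (∑ i, (u i).card) + h ≤ h * h ∨ (∑ j, (w j).card) + h ≤ h * h
  · exact ChowFacePrivate.chowHits_of_thin h r u w hu hw h1
  · push Not at h1
    exact hT h hh r u w hu hw (by omega) (by omega)

/-- **COMPOSITION (by name): the thick lower-set node closes the item** (G2 + p704381). -/
theorem ChowHitsPartitionMinorsR_of_thickLowerSets : Stmt.stub_thickLowerSetsChowR → ItemByName :=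
  fun hT => by
    obtain ⟨h₀, hyp⟩ := stub_lowerSetsChowR_of_thick hT
    exact ChowLowerSets.chowHitsPartitionMinorsR_of_lowerSets h₀ hyp

/-- **COMPOSITION (by name): the unrestricted lower-set node closes the item** (p704381). -/
theorem ChowHitsPartitionMinorsR_of_lowerSets' : Stmt.stub_lowerSetsChowR → ItemByName :=
  fun ⟨h₀, hyp⟩ => ChowLowerSets.chowHitsPartitionMinorsR_of_lowerSets h₀ hyp

/-- sanity (kernel): the item implies the thick-pairs node (the node is a restriction of the item). -/
theorem stub_thickPairsChowR_of_item (H : ChowHitsPartitionMinorsR) : Stmt.stub_thickPairsChowR := by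
  obtain ⟨h₀, H⟩ := H
  exact ⟨h₀, fun h hh r u w hu hw _ _ => H h hh r u w hu hw⟩



/-- **THE ITEM FROM THE LINE (v2, literal concluder): the narrowed thick-pairs node closes item 21882** (glue p720686 + G1 case split). -/
theorem ChowHitsPartitionMinorsR_of_thickPairsNoStar : Stmt.stub_thickPairsChowRNoStar → ItemByName :=
  fun H => ChowHitsPartitionMinorsR_of_thickPairs
    (stub_thickPairsChowR_iff.mpr (Summit.ValiantsHypothesis.ValiantsHypothesis.Theorems.BarrierLever.ChowNoStar.stub_thickPairsChowR_of_noStar (stub_thickPairsChowRNoStar_iff.mp H)))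

/-- The narrowed LS node closes the item too (glue p720686, then the v1 LS composition); concludes `ItemByName`. -/
theorem ChowHitsPartitionMinorsR_of_thickLowerSetsNoStar : Stmt.stub_thickLowerSetsChowRNoStar → ItemByName :=
  fun H => ChowHitsPartitionMinorsR_of_thickLowerSets
    (stub_thickLowerSetsChowR_iff.mpr (Summit.ValiantsHypothesis.ValiantsHypothesis.Theorems.BarrierLever.ChowNoStar.stub_thickLowerSetsChowR_of_noStar (stub_thickLowerSetsChowRNoStar_iff.mp H)))



/-- **THE ITEM FROM THE LINE (v3, literal concluder): the NoBiStar thick-pairs node closes item 21882** (p717689 glue, then the v2 chain). -/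
theorem ChowHitsPartitionMinorsR_of_thickPairsNoBiStar : Stmt.stub_thickPairsChowRNoBiStar → ItemByName :=
  fun H => ChowHitsPartitionMinorsR_of_thickPairsNoStar
    (stub_thickPairsChowRNoStar_iff.mpr (Summit.ValiantsHypothesis.ValiantsHypothesis.Theorems.BarrierLever.ChowNoStar.stub_thickPairsChowRNoStar_of_noBiStar (stub_thickPairsChowRNoBiStar_iff.mp H)))

/-- The NoBiStar LS node closes the item too; concludes `ItemByName`. -/
theorem ChowHitsPartitionMinorsR_of_thickLowerSetsNoBiStar : Stmt.stub_thickLowerSetsChowRNoBiStar → ItemByName :=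
  fun H => ChowHitsPartitionMinorsR_of_thickLowerSetsNoStar
    (stub_thickLowerSetsChowRNoStar_iff.mpr (Summit.ValiantsHypothesis.ValiantsHypothesis.Theorems.BarrierLever.ChowNoStar.stub_thickLowerSetsChowRNoStar_of_noBiStar (stub_thickLowerSetsChowRNoBiStar_iff.mp H)))
/-- v4 glue inside the skeleton (by name): NoMD ⟹ NoStarved ⟹ NoBiStar, pairs node. -/
theorem stub_thickPairsChowRNoBiStar_of_noMD' (H : Stmt.stub_thickPairsChowRNoMD) : Stmt.stub_thickPairsChowRNoBiStar :=
  stub_thickPairsChowRNoBiStar_iff.mpr (Summit.ValiantsHypothesis.ValiantsHypothesis.Theorems.BarrierLever.ChowNoStar.stub_thickPairsChowRNoBiStar_of_noStarved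
    (Summit.ValiantsHypothesis.ValiantsHypothesis.Theorems.BarrierLever.ChowNoStar.stub_thickPairsChowRNoStarved_of_noMD (stub_thickPairsChowRNoMD_iff.mp H)))

/-- v4 glue inside the skeleton (by name): NoMD ⟹ NoStarved ⟹ NoBiStar, lower-sets node. -/
theorem stub_thickLowerSetsChowRNoBiStar_of_noMD' (H : Stmt.stub_thickLowerSetsChowRNoMD) : Stmt.stub_thickLowerSetsChowRNoBiStar :=
  stub_thickLowerSetsChowRNoBiStar_iff.mpr (Summit.ValiantsHypothesis.ValiantsHypothesis.Theorems.BarrierLever.ChowNoStar.stub_thickLowerSetsChowRNoBiStar_of_noStarved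
    (Summit.ValiantsHypothesis.ValiantsHypothesis.Theorems.BarrierLever.ChowNoStar.stub_thickLowerSetsChowRNoStarved_of_noMD (stub_thickLowerSetsChowRNoMD_iff.mp H)))

/-- **THE ITEM FROM THE LINE (v4, literal concluder): the NoMD thick-pairs node closes item 21882** (p729761 + p728631 glue, then the v3 chain). -/
theorem ChowHitsPartitionMinorsR_of :
    Stmt.stub_thickPairsChowRNoMD → Theses.BarrierLever.ChowHitsPartitionMinorsR :=
  fun H => ChowHitsPartitionMinorsR_of_thickPairsNoBiStar (stub_thickPairsChowRNoBiStar_of_noMD' H)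

/-- The NoMD LS node closes the item too; concludes `ItemByName`. -/
theorem ChowHitsPartitionMinorsR_of_thickLowerSetsNoMD : Stmt.stub_thickLowerSetsChowRNoMD → ItemByName :=
  fun H => ChowHitsPartitionMinorsR_of_thickLowerSetsNoBiStar (stub_thickLowerSetsChowRNoBiStar_of_noMD' H)

/-- The intermediate NoStarved nodes close the item (by name, `ItemByName`). -/
theorem ChowHitsPartitionMinorsR_of_thickPairsNoStarved' : Stmt.stub_thickPairsChowRNoStarved → ItemByName :=
  fun H => ChowHitsPartitionMinorsR_of_thickPairsNoBiStar
    (stub_thickPairsChowRNoBiStar_iff.mpr (Summit.ValiantsHypothesis.ValiantsHypothesis.Theorems.BarrierLever.ChowNoStar.stub_thickPairsChowRNoBiStar_of_noStarved (stub_thickPairsChowRNoStarved_iff.mp H)))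

theorem ChowHitsPartitionMinorsR_of_thickLowerSetsNoStarved' : Stmt.stub_thickLowerSetsChowRNoStarved → ItemByName :=
  fun H => ChowHitsPartitionMinorsR_of_thickLowerSetsNoBiStar
    (stub_thickLowerSetsChowRNoBiStar_iff.mpr (Summit.ValiantsHypothesis.ValiantsHypothesis.Theorems.BarrierLever.ChowNoStar.stub_thickLowerSetsChowRNoBiStar_of_noStarved (stub_thickLowerSetsChowRNoStarved_iff.mp H)))

/-- v5 glue inside the skeleton (by name): LargeDefect ⟹ NoMD, lower-sets node (THEOREM H). -/
theorem stub_thickLowerSetsChowRNoMD_of_largeDefect' (H : Stmt.stub_thickLowerSetsChowRLargeDefect) : Stmt.stub_thickLowerSetsChowRNoMD :=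
  stub_thickLowerSetsChowRNoMD_iff.mpr (Summit.ValiantsHypothesis.ValiantsHypothesis.Theorems.BarrierLever.ChowNoStar.stub_thickLowerSetsChowRNoMD_of_largeDefect (stub_thickLowerSetsChowRLargeDefect_iff.mp H))

/-- The LARGE-DEFECT LS node (v5, registered) closes the item; concludes `ItemByName` (the literal concluder stays on the thick-pairs node). -/
theorem ChowHitsPartitionMinorsR_of_thickLowerSetsLargeDefect : Stmt.stub_thickLowerSetsChowRLargeDefect → ItemByName :=
  fun H => ChowHitsPartitionMinorsR_of_thickLowerSetsNoMD (stub_thickLowerSetsChowRNoMD_of_largeDefect' H)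

/-- The registered concluding stub closes the item (v5 audit shape: literal concluder applied to the registered thick-pairs node). -/
theorem ChowHitsPartitionMinorsR_holds : Theses.BarrierLever.ChowHitsPartitionMinorsR :=
  ChowHitsPartitionMinorsR_of stub_thickPairsChowRNoMD


end Summit.ValiantsHypothesis.ValiantsHypothesis.Cruxes.ChowHitsPartitionMinorsR.AffineLower
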